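import Literature.Probability.RandomPlanarGeometry.HexSAWHalfSpaceKestenTwo
import Literature.Probability.RandomPlanarGeometry.HexSAWBrickWallHalfSpace
import Literature.Probability.RandomPlanarGeometry.HexSAWHammersleyWelshLog
import Literature.Probability.RandomPlanarGeometry.SAWRatioRateUpperCubeRoot
import Literature.Probability.RandomPlanarGeometry.SAWEndpointRateLowerInsertion
import Mathlib.Analysis.SpecialFunctions.Pow.Real
import HarnessLib

/-!
# The two-step ratio of half-space walks on the hexagonal lattice: `h_{N+2}(ℍ)/h_N(ℍ) → 2 + √2` at rate `N^{-1/3}`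

Topic `Literature/Probability/RandomPlanarGeometry`. Lane «pcv-sawmu», door R79 «HEX-HALFSPACE-RATIO-2(-RATE)».
For the brick-wall half-space walks `HexBW.halfSpaceCount` (`HexSAWBrickWallWalks.lean`, height = coordinate `0`):
**`hexHalfSpaceRatioTwo_rate : ∃ K, ∀ N ≥ 1, |h_{N+2}(ℍ)/h_N(ℍ) − (2+√2)| ≤ K·N^{-1/3}`** and the limit
**`hexHalfSpaceRatioTwo : h_{N+2}(ℍ)/h_N(ℍ) → 2 + √2 = μ_ℍ²`** (Duminil-Copin–Smirnov), NO hypotheses.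

Mechanism (Kesten's cube root on both sides, two-step, no doubling): Kesten's two-step inequality for `h_N(ℍ)`
(`HV.hexHalfSpaceKestenTwo`, `HexSAWHalfSpaceKestenTwo.lean`) in the `B`-form; the UPPER side from prefix-closure
against all walks `h_{n+k} ≤ h_n c_k` (`HexBW.halfSpaceCount_add_le`) with the walk envelope
`hexHWExplicit_fourteen`, via `Zd.KestenRateUpper.upper_rate_cubeRoot_sub`; the LOWER side from bridge-prefixing
`b_k h_n ≤ h_{k+n}` (`HexBW.bridgeCount_mul_halfSpaceCount_le`) with the even-length bridge envelope
`e^{-9√M} μ^{2M} ≤ μ b_{2M}` (`HexBW.exp_neg_mul_sqrt_mul_pow_le_bridgeCount`), via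
`Zd.KestenRateLower.lower_rate_cubeRoot_ins` on both residues; monotonicity `h_n ≤ h_{n+2}`
(`HexBW.halfSpaceCount_le_add_two`).  The abstract pieces (§1) and the glue (§2) are a-idea-1 g13's
`Sketch_G13_R79` §1–§2, carried verbatim as private lemmas; the inputs are a-p6 g5's `HexSAWBrickWallHalfSpace.lean`
/ `HexSAWBrickWallBridgeEnvelope.lean` and this seat's `HexSAWHalfSpaceKestenTwo.lean`.

Status in print: NO count-ratio statement (limit or rate) for half-plane self-avoiding walks on the honeycomb lattice
is printed (nearest: the critical surface fugacity `1 + √2` of Beaton–Bousquet-Mélou–de Gier–Duminil-Copin–Guttmann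
2014, and the strip identities of Duminil-Copin–Smirnov 2012).  On `ℤ^d`: the one-step half-space ratio limit is
Lawler–Schramm–Werner 2004 (A.3) (`h_{N+1}/h_N → μ`, hence the two-step form); Kesten's inequality for bridges is
Madras–Slade 1993 Theorem 7.3.2 (b) (7.3.4) p. 244 and the BRIDGE two-step limit `b_{N+2}/b_N → μ²` is (7.3.13) p. 248
(tree: `Zd.MadrasSlade1993_thm732b`, `Zd.MadrasSlade1993_eq7313`); the all-walks two-step limit is Theorem 7.3.4 (a)
p. 248 and the all-walks two-step RATE is (7.5.1) p. 255 (stated there without proof); the surgery inside a sub-class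
`W_N` of walks is the proof of Theorem 7.3.2, p. 245.  New in writing; consolidation / new combination of printed mechanisms; first kernel
text.
-/

noncomputable section

open Filter Topology

namespace Literature.Probability.RandomPlanarGeometry.SAW

/-! ## §1 Abstract pieces (a-idea-1 g13, verbatim) -/

/-- From the product form of Kesten's two-step inequality (eventually) and `b_n ≤ b_{n+2}` to the `B`-form
`b_{n+2}/b_n − B/n ≤ b_{n+4}/b_{n+2}` for all `n ≥ 1`. [cite: MadrasSlade1993, Lemma 7.3.1 (iii) (7.3.1) and Theorem 7.3.2 (b) (7.3.4), p. 244] -/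
private theorem kesten_B_form_of_product_two_all {b : ℕ → ℝ} (hb : ∀ n, 0 < b n)
    (hmono2 : ∀ n, b n ≤ b (n + 2))
    (hK : ∃ D : ℝ, ∀ᶠ N : ℕ in atTop,
      (b (N + 2) / b N) ^ 2 - D / N ≤ (b (N + 2) / b N) * (b (N + 4) / b (N + 2))) :
    ∃ B : ℝ, 1 ≤ B ∧ ∀ n : ℕ, 1 ≤ n → b (n + 2) / b n - B / n ≤ b (n + 4) / b (n + 2) := by
  obtain ⟨D, hD⟩ := hK
  obtain ⟨N₀, hN₀⟩ := Filter.eventually_atTop.1 hD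
  have hφ1 : ∀ n, 1 ≤ b (n + 2) / b n := fun n => by
    rw [le_div_iff₀ (hb n), one_mul]; exact hmono2 n
  obtain ⟨S, hS⟩ : ∃ S : ℝ, S = ∑ k ∈ Finset.range N₀, (k : ℝ) * (b (k + 2) / b k) := ⟨_, rfl⟩
  have hS0 : ∀ k : ℕ, 0 ≤ (k : ℝ) * (b (k + 2) / b k) := fun k => by
    have := hφ1 k; positivity
  obtain ⟨B, hB⟩ : ∃ B : ℝ, B = max (max |D| 1) S := ⟨_, rfl⟩
  refine ⟨B, by rw [hB]; exact (le_max_right _ _).trans (le_max_left _ _), fun n hn => ?_⟩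
  have hn0 : (0 : ℝ) < n := by exact_mod_cast hn
  rcases Nat.lt_or_ge n N₀ with hlt | hge
  · have h1 : (n : ℝ) * (b (n + 2) / b n) ≤ S := by
      rw [hS]
      exact Finset.single_le_sum (fun k _ => hS0 k) (Finset.mem_range.2 hlt)
    have h2 : b (n + 2) / b n ≤ B / n := by
      rw [le_div_iff₀ hn0]
      calc b (n + 2) / b n * n = (n : ℝ) * (b (n + 2) / b n) := by ring
        _ ≤ S := h1
        _ ≤ B := by rw [hB]; exact le_max_right _ _
    have h3 := hφ1 (n + 2)
    linarith
  · have hKn := hN₀ n hge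
    obtain ⟨r, hr⟩ : ∃ r : ℝ, r = b (n + 2) / b n := ⟨_, rfl⟩
    rw [← hr] at hKn ⊢
    have hr1 : 1 ≤ r := by rw [hr]; exact hφ1 n
    have hr0 : 0 < r := by linarith
    have key : r - D / (n * r) ≤ b (n + 4) / b (n + 2) := by
      have h1 : r * (r - D / (n * r)) = r ^ 2 - D / n := by field_simp
      have h2 : r * (r - D / (n * r)) ≤ r * (b (n + 4) / b (n + 2)) := by rw [h1]; exact hKn
      exact le_of_mul_le_mul_left h2 hr0
    have hDB : D / (n * r) ≤ B / n := by
      calc D / (n * r) ≤ |D| / (n * r) := div_le_div_of_nonneg_right (le_abs_self D) (by positivity)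
        _ ≤ |D| / (n * 1) :=
            div_le_div_of_nonneg_left (abs_nonneg D) (by positivity) (mul_le_mul_of_nonneg_left hr1 hn0.le)
        _ = |D| / n := by rw [mul_one]
        _ ≤ B / n := div_le_div_of_nonneg_right (by rw [hB]; exact (le_max_left _ _).trans (le_max_left _ _)) hn0.le
    linarith

/-- **Two-sided cube-root TWO-step rate, abstract two-sequence form**: Kesten's `B`-form inequality for `h`,
super-multiplicativity against `b` on the left (`b_k h_n ≤ h_{k+n}`), sub-multiplicativity against `c` on the
right (`h_{n+k} ≤ h_n c_k`), the even-length lower envelope `e^{-κ√M} ν^{2M} ≤ A b_{2M}` and the upper envelope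
`c_k ≤ A' e^{κ'√k} ν^k` give `|h_{N+2}/h_N − ν²| ≤ K N^{-1/3}`. [cite: MadrasSlade1993, Theorem 7.3.2 (proof) and §7.5 (7.5.1)–(7.5.2), p. 255] -/
private theorem twoStep_rate_cubeRoot_twoSeq {h b c : ℕ → ℝ} {ν B κ κ' A A' : ℝ} (hh : ∀ n, 0 < h n)
    (hν1 : 1 ≤ ν) (hB1 : 1 ≤ B) (hκ : 0 ≤ κ) (hκ' : 0 ≤ κ') (hA : 1 ≤ A) (hA' : 1 ≤ A')
    (hK : ∀ n : ℕ, 1 ≤ n → h (n + 2) / h n - B / n ≤ h (n + 4) / h (n + 2))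
    (hsup : ∀ k n : ℕ, b k * h n ≤ h (k + n)) (hsub : ∀ n k : ℕ, h (n + k) ≤ h n * c k)
    (hblo : ∀ M : ℕ, 1 ≤ M → Real.exp (-(κ * Real.sqrt M)) * ν ^ (2 * M) ≤ A * b (2 * M))
    (hchi : ∀ k : ℕ, c k ≤ A' * Real.exp (κ' * Real.sqrt k) * ν ^ k) :
    ∃ K : ℝ, ∀ N : ℕ, 1 ≤ N → |h (N + 2) / h N - ν ^ 2| ≤ K * (N : ℝ) ^ (-(1 : ℝ) / 3) := by
  -- enlarge `B` so that `ν² ≤ B'`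
  obtain ⟨B', hB'⟩ : ∃ B' : ℝ, B' = B + ν ^ 2 := ⟨_, rfl⟩
  have hν0 : 0 < ν := by linarith
  have hB'1 : 1 ≤ B' := by rw [hB']; nlinarith
  have hB'ν : ν ^ 2 ≤ B' := by rw [hB']; linarith
  have hK' : ∀ n : ℕ, 1 ≤ n → h (n + 2) / h n - B' / n ≤ h (n + 4) / h (n + 2) := by
    intro n hn
    have hn0 : (0 : ℝ) < n := by exact_mod_cast hn
    have : B / n ≤ B' / n := div_le_div_of_nonneg_right (by rw [hB']; nlinarith) hn0.le
    linarith [hK n hn]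
  -- UPPER: `a := h`, `a₂ M := c (2M)`, constant `2κ'`
  have hsub' : ∀ N M : ℕ, h (N + 2 * M) ≤ h N * c (2 * M) := fun N M => hsub N (2 * M)
  have hhi' : ∀ M : ℕ, c (2 * M) ≤ A' * Real.exp (2 * κ' * Real.sqrt M) * ν ^ (2 * M) := by
    intro M
    refine (hchi (2 * M)).trans ?_
    have hs : Real.sqrt ((2 * M : ℕ) : ℝ) ≤ 2 * Real.sqrt M := by
      rw [show (2 : ℝ) * Real.sqrt M = Real.sqrt (4 * M) by
        rw [Real.sqrt_mul (by norm_num), show Real.sqrt 4 = 2 by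
          rw [show (4 : ℝ) = 2 ^ 2 by norm_num, Real.sqrt_sq (by norm_num)]]]
      exact Real.sqrt_le_sqrt (by push_cast; linarith [(Nat.cast_nonneg M : (0 : ℝ) ≤ M)])
    have h1 : Real.exp (κ' * Real.sqrt ((2 * M : ℕ) : ℝ)) ≤ Real.exp (2 * κ' * Real.sqrt M) :=
      Real.exp_le_exp.2 (by nlinarith)
    have h2 : (0 : ℝ) ≤ ν ^ (2 * M) := by positivity
    have h3 : (0 : ℝ) ≤ A' := by linarith
    exact mul_le_mul_of_nonneg_right (mul_le_mul_of_nonneg_left h1 h3) h2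
  obtain ⟨K₁, hK₁⟩ := Zd.KestenRateUpper.upper_rate_cubeRoot_sub (a := h) (a₂ := fun M => c (2 * M)) hh hν1
    hB'1 hA' hK' hsub' hhi'
  -- LOWER: `e M := b (2M)`, both residues
  have hlo' : ∀ M : ℕ, 2 ≤ M → Real.exp (-(κ * Real.sqrt M)) * ν ^ (2 * M) ≤ A * b (2 * M) :=
    fun M hM => hblo M (by omega)
  have hSM : ∀ r : ℕ, ∀ N' M : ℕ, 0 ≤ N' → N' % 2 = r → 2 ≤ M →
      h N' * b (2 * M) ≤ (2 * ((N' : ℝ) + 2 * M) + 3) ^ 6 * h (N' + 2 * M) := by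
    intro r N' M _ _ _
    have h1 : h N' * b (2 * M) ≤ h (N' + 2 * M) := by
      rw [mul_comm, show N' + 2 * M = 2 * M + N' by ring]; exact hsup _ _
    have h2 : (1 : ℝ) ≤ (2 * ((N' : ℝ) + 2 * M) + 3) ^ 6 :=
      one_le_pow₀ (by have : (0 : ℝ) ≤ (N' : ℝ) := Nat.cast_nonneg _; have : (0:ℝ) ≤ (M : ℝ) := Nat.cast_nonneg _; linarith)
    have h3 : 0 ≤ h (N' + 2 * M) := (hh _).le
    nlinarith
  obtain ⟨K₂, hK₂⟩ := Zd.KestenRateLower.lower_rate_cubeRoot_ins (a := h) (e := fun M => b (2 * M)) (n₁ := 0)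
    (r := 0) hh hν1 hB'1 hB'ν hκ hA hK' hlo' (hSM 0)
  obtain ⟨K₃, hK₃⟩ := Zd.KestenRateLower.lower_rate_cubeRoot_ins (a := h) (e := fun M => b (2 * M)) (n₁ := 0)
    (r := 1) hh hν1 hB'1 hB'ν hκ hA hK' hlo' (hSM 1)
  obtain ⟨K, hKdef⟩ : ∃ K : ℝ, K = max (max K₁ (max K₂ K₃)) 0 := ⟨_, rfl⟩
  have hK0 : 0 ≤ K := by rw [hKdef]; exact le_max_right _ _
  have hK1K : K₁ ≤ K := by rw [hKdef]; exact (le_max_left _ _).trans (le_max_left _ _)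
  have hK2K : K₂ ≤ K := by
    rw [hKdef]; exact ((le_max_left _ _).trans (le_max_right _ _)).trans (le_max_left _ _)
  have hK3K : K₃ ≤ K := by
    rw [hKdef]; exact ((le_max_right _ _).trans (le_max_right _ _)).trans (le_max_left _ _)
  refine ⟨K, fun N hN => ?_⟩
  have hr0 : 0 ≤ (N : ℝ) ^ (-(1 : ℝ) / 3) := by positivity
  have lift : ∀ {K' x : ℝ}, K' ≤ K → x ≤ K' * (N : ℝ) ^ (-(1 : ℝ) / 3) → x ≤ K * (N : ℝ) ^ (-(1 : ℝ) / 3) :=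
    fun hK' hx => hx.trans (mul_le_mul_of_nonneg_right hK' hr0)
  have hKN : 0 ≤ K * (N : ℝ) ^ (-(1 : ℝ) / 3) := mul_nonneg hK0 hr0
  rw [abs_le]
  constructor
  · by_cases hv : h (N + 2) / h N - ν ^ 2 < 0
    · obtain ⟨v, hvdef⟩ : ∃ v : ℝ, v = ν ^ 2 - h (N + 2) / h N := ⟨_, rfl⟩
      have hv0 : 0 < v := by linarith
      have hdev : h (N + 2) / h N ≤ ν ^ 2 - v := by linarith
      rcases Nat.mod_two_eq_zero_or_one N with h0 | h1
      · have := lift hK2K (hK₂ N (by omega) h0 v hv0 hdev); linarith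
      · have := lift hK3K (hK₃ N (by omega) h1 v hv0 hdev); linarith
    · linarith
  · by_cases hu : 0 < h (N + 2) / h N - ν ^ 2
    · have hdev : ν ^ 2 + (h (N + 2) / h N - ν ^ 2) ≤ h (N + 2) / h N := by linarith
      exact lift hK1K (hK₁ N hN _ hu hdev)
    · linarith

/-! ## §2 The theorems for `h_N(ℍ)` -/

/-- **Two-step ratio rate for half-space walks on the hexagonal lattice**: there is `K` with
`|h_{N+2}(ℍ)/h_N(ℍ) − (2 + √2)| ≤ K · N^{-1/3}` for every `N ≥ 1`, where `h_N(ℍ) = HexBW.halfSpaceCount N` counts the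
`N`-step honeycomb walks (brick-wall frame) staying strictly above the height of their starting point.  Inputs:
Kesten's two-step inequality `HV.hexHalfSpaceKestenTwo`, `h_n ≤ h_{n+2}`, `b_k h_n ≤ h_{k+n}`, `h_{n+k} ≤ h_n c_k`,
the bridge lower envelope and the Hammersley–Welsh walk envelope; `μ_ℍ² = 2 + √2` by Duminil-Copin–Smirnov.  Not in
print for `ℍ`; on `ℤ^d` the bridge two-step limit is (7.3.13) and the all-walks two-step rate is (7.5.1). [cite: MadrasSlade1993, Theorem 7.3.2 (b) (7.3.4) p. 244, (7.3.13) p. 248, proof of Theorem 7.3.2 p. 245 (sub-class W_N); §7.5 (7.5.1)–(7.5.2) p. 255] -/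
theorem hexHalfSpaceRatioTwo_rate : ∃ K : ℝ, ∀ N : ℕ, 1 ≤ N →
    |(HexBW.halfSpaceCount (N + 2) : ℝ) / HexBW.halfSpaceCount N - (2 + Real.sqrt 2)| ≤
      K * (N : ℝ) ^ (-(1 : ℝ) / 3) := by
  have hμ := hexConnectiveConstant_eq_of_thm1 DuminilCopinSmirnov2012_thm1_holds
  have hμpos : 0 < hexConnectiveConstant := hexConnectiveConstant_pos
  have hμsq : hexConnectiveConstant ^ 2 = 2 + Real.sqrt 2 := by
    rw [hμ]; exact Real.sq_sqrt (by positivity)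
  have hμ1 : 1 ≤ hexConnectiveConstant := by
    have h2 : (1 : ℝ) ≤ hexConnectiveConstant ^ 2 := by
      rw [hμsq]; have := Real.sqrt_nonneg 2; linarith
    nlinarith
  have hh : ∀ n, (0 : ℝ) < HexBW.halfSpaceCount n := fun n => by
    have h1 : (1 : ℝ) ≤ HexBW.bridgeCount n := by exact_mod_cast HexBW.one_le_bridgeCount n
    have h2 : (HexBW.bridgeCount n : ℝ) ≤ HexBW.halfSpaceCount n := by
      exact_mod_cast Finset.card_le_card (HexBW.bridges_subset_halfSpaceWalks n)
    linarith
  have hmono' : ∀ n, (HexBW.halfSpaceCount n : ℝ) ≤ HexBW.halfSpaceCount (n + 2) := fun n => by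
    exact_mod_cast HexBW.halfSpaceCount_le_add_two n
  obtain ⟨B, hB1, hB⟩ := kesten_B_form_of_product_two_all hh hmono' HV.hexHalfSpaceKestenTwo
  have hsup' : ∀ k n : ℕ, (HexBW.bridgeCount k : ℝ) * HexBW.halfSpaceCount n ≤ HexBW.halfSpaceCount (k + n) :=
    fun k n => by exact_mod_cast HexBW.bridgeCount_mul_halfSpaceCount_le k n
  have hsub' : ∀ n k : ℕ, (HexBW.halfSpaceCount (n + k) : ℝ) ≤ HexBW.halfSpaceCount n * hexSawCount k :=
    fun n k => by exact_mod_cast HexBW.halfSpaceCount_add_le n k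
  obtain ⟨A₀, hA₀⟩ := hexHWExplicit_fourteen
  have hchi : ∀ k : ℕ, (hexSawCount k : ℝ) ≤
      max A₀ 1 * Real.exp (14 * Real.sqrt k) * hexConnectiveConstant ^ k := by
    intro k
    rcases Nat.eq_zero_or_pos k with hk | hk
    · subst hk
      simp only [hexSawCount_zero, Nat.cast_one, Nat.cast_zero, Real.sqrt_zero, mul_zero, Real.exp_zero,
        mul_one, pow_zero]
      exact le_max_right _ _
    · refine (hA₀ k hk).trans ?_
      have h2 : (0 : ℝ) ≤ Real.exp (14 * Real.sqrt k) * hexConnectiveConstant ^ k := by positivity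
      calc A₀ * Real.exp (14 * Real.sqrt k) * hexConnectiveConstant ^ k
          = A₀ * (Real.exp (14 * Real.sqrt k) * hexConnectiveConstant ^ k) := by ring
        _ ≤ max A₀ 1 * (Real.exp (14 * Real.sqrt k) * hexConnectiveConstant ^ k) :=
            mul_le_mul_of_nonneg_right (le_max_left _ _) h2
        _ = _ := by ring
  have hblo' : ∀ M : ℕ, 1 ≤ M → Real.exp (-(9 * Real.sqrt M)) * hexConnectiveConstant ^ (2 * M) ≤
      hexConnectiveConstant * (HexBW.bridgeCount (2 * M) : ℝ) :=
    fun M hM => HexBW.exp_neg_mul_sqrt_mul_pow_le_bridgeCount M hM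
  obtain ⟨K, hK⟩ := twoStep_rate_cubeRoot_twoSeq (h := fun n => (HexBW.halfSpaceCount n : ℝ))
    (b := fun n => (HexBW.bridgeCount n : ℝ)) (c := fun n => (hexSawCount n : ℝ)) hh hμ1 hB1
    (by norm_num : (0 : ℝ) ≤ 9) (by norm_num : (0 : ℝ) ≤ 14) hμ1 (le_max_right _ _) hB hsup' hsub' hblo' hchi
  refine ⟨K, fun N hN => ?_⟩
  have := hK N hN
  rwa [hμsq] at this

/-- **`h_{N+2}(ℍ)/h_N(ℍ) → 2 + √2 = μ_ℍ²`**: the two-step ratio of half-space self-avoiding walks on the hexagonal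
lattice converges to the square of the connective constant `√(2+√2)` (from the rate `hexHalfSpaceRatioTwo_rate`).
Not in print for `ℍ` (on `ℤ^d` the one-step half-space ratio limit is Lawler–Schramm–Werner 2004 (A.3)); the
`ℤ^d` bridge two-step limit is (7.3.13) and the all-walks two-step limit is Theorem 7.3.4 (a).
[cite: MadrasSlade1993, (7.3.13) and Theorem 7.3.4 (a), p. 248] -/
theorem hexHalfSpaceRatioTwo :
    Tendsto (fun N : ℕ => (HexBW.halfSpaceCount (N + 2) : ℝ) / HexBW.halfSpaceCount N) atTop
      (𝓝 (2 + Real.sqrt 2)) := by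
  obtain ⟨K, hK⟩ := hexHalfSpaceRatioTwo_rate
  have h3 : Tendsto (fun N : ℕ => K * (N : ℝ) ^ (-(1 : ℝ) / 3)) atTop (𝓝 0) := by
    have := (tendsto_rpow_neg_atTop (by norm_num : (0 : ℝ) < 1 / 3)).comp tendsto_natCast_atTop_atTop
    simpa [neg_div] using this.const_mul K
  have hdiff : Tendsto (fun N : ℕ => (HexBW.halfSpaceCount (N + 2) : ℝ) / HexBW.halfSpaceCount N -
      (2 + Real.sqrt 2)) atTop (𝓝 0) := by
    refine tendsto_of_tendsto_of_tendsto_of_le_of_le' (by simpa using h3.neg) h3 ?_ ?_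
    · exact Filter.eventually_atTop.2 ⟨1, fun N hN => (abs_le.1 (hK N hN)).1⟩
    · exact Filter.eventually_atTop.2 ⟨1, fun N hN => (abs_le.1 (hK N hN)).2⟩
  have := hdiff.add_const (2 + Real.sqrt 2)
  simpa using this

end Literature.Probability.RandomPlanarGeometry.SAW
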